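import Mathlib
import HarnessLib

/-!
# Markman 2025 [C] — §11.2.1 («The case `[K : ℚ] = 4`», `F = ℚ(√t)`, `K = F(√−q)`): the subalgebra
# `⟨H^{1,1}(X, ℚ)⟩` with `Θ_{σ̂ᵢ}³ = 0`, the secant plane basis `{α, β, α̃, √tβ̃}` of `B_{√−qΘ}`
# («`exp(√−qΘ) = α + √−qβ`», «`α − α̃ = −2qΘ_{σ̂₁}Θ_{σ̂₂}`»), the display of LEMMA 11.2.3, the `F`-structure
# «`(f·Θ)³ = Nm(f)f·Θ³`», the scalar steps of LEMMAS 11.2.3–11.2.5, COR. 11.2.6 (1) and the RANK DISPLAY closing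
# LEMMA 11.2.8 — AS PRINTED (v1 p. 40 L6 – p. 43 L21), kernel-checked

E. Markman: [C] *Secant sheaves on abelian n-folds with real multiplication and Weil classes on abelian 2n-folds with
complex multiplication*, arXiv:2509.23079 **v1** (2025-09-27, the only version), bib `Markman2025SecantRealMultiplication`
— UNREFEREED PREPRINT. «v1 p. N L m» = PyMuPDF line `m` of PDF page `N` of the public arXiv PDF (sha256/16
`57d91afec2bfe09f`); PRINTED numbering (§11.2 = held-corpus §12.2). Read at seat lit-w-markman g22 (pub-hsemireg
LIT-W, 2026-08-25; p. 40–41 from the numbered text layer and BY EYE on the renders `r_mar25c_p40_sec1121.png`,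
`r_mar25c_p41_lemmas1123_1125.png`, `r_mar25c_p42_cor1126_lemma1128.png`, `r_mar25c_p43_rank.png` in
`HOME/lit/Markman-renders-litw-markman-g22/`; sheet `LOCATOR-SHEET-MARKMAN.md` §69–§70). This is the `[F : ℚ] = 2` example (Jacobian of a genus-4 curve with real multiplication by `ℚ(√t)`) that the
pub-hsemireg W3 rows (RM Jacobians ∕ non-product CM types) score against; companion `RMIsometryBlockForm.lean`
(§11.1's `ρ_{g₀} = exp(ν)`), `BBGradingDimensionCounts.lean` (§10.1–10.2).

## What is printed (verbatim, by eye; displays linearised)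

* v1 p. 40 L13–28: «The subspace `B_{√−qΘ}` is `τ`-invariant … and it is contained in the subalgebra `⟨H^{1,1}(X, ℚ)⟩`
  of `S⁺_ℚ = H^{ev}(X, ℚ)` generated by `H^{1,1}(X, ℚ)`. Write `Θ = Θ_{σ̂₁} + Θ_{σ̂₂}` as above. Then `Θ³_{σ̂ᵢ} = 0`, since
  `H¹_{σ̂ᵢ}(X)` is 4-dimensional. Thus, the subalgebra `⟨H^{1,1}(X, ℚ)⟩` is 9-dimensional with the basis
  `{1, Θ, √tΘ̃, Θ², ΘΘ̃, Θ̃², Θ³, √tΘ̃³, [pt]}`, where `Θ̃ := Θ_{σ̂₁} − Θ_{σ̂₂}` …» — p. 40 L45–47: «These two lines form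
  the boundary of the ample cone, since `Θ⁴_{σ̂ᵢ} = 0`.»
* v1 p. 40 L52–61: «Set `α := 1 − (q/2)Θ² + (q²/4!)Θ⁴` and `β := Θ − (q/3!)Θ³`. Then `exp(√−qΘ) = α + √−qβ`. Define `α̃`
  and `β̃` similarly in terms of `Θ̃`. Then `B_{√−qΘ}` has the basis `{α, β, α̃, √tβ̃}`. Note that `α − α̃ =
  −2qΘ_{σ̂₁}Θ_{σ̂₂}` is an element of `B_{√−qΘ}` spanning a line which is independent of the choice of `Θ`.»
* v1 p. 40 L62–96: «Given an element `f ∈ F` and a class `δ` in the `F`-vector space `∧^*_F H¹(X, ℚ)`, denote by `f · δ`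
  the scalar multiplication of `δ` by `f` … We choose `σ̂₁` to map `√t` to the positive square root … So `(a + b√t)Θ =
  (a + b√t)Θ_{σ̂₁} + (a + b√t)Θ_{σ̂₂}`, while `(a + b√t) · Θ = (a + b√t)Θ_{σ̂₁} + (a − b√t)Θ_{σ̂₂}`. … Given `f ∈ F`, let
  `M_f ∈ End[∧²_F H¹(X, ℚ) ⊕ H⁶(X, ℚ)]` send `(x, y)` to `(f² · x, Nm(f²)y)`.»
* LEMMA 11.2.3 and its proof (p. 41 L3–65): «The endomorphism `M_f` maps `B_{√−qΘ} ∩ [∧²_F H¹(X, ℚ) ⊕ H⁶(X, ℚ)]` to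
  `B_{√−qf·Θ} ∩ [∧²_F H¹(X, ℚ) ⊕ H⁶(X, ℚ)]`. Proof. We have the equality `−(q/3!)(aΘ³ + b√tΘ̃³) =
  −(q/2)Θ_{σ̂₁}Θ_{σ̂₂}[(a − b√t)Θ_{σ̂₁}) + (a + b√t)Θ_{σ̂₂})] = −(q/2)Θ_{σ̂₁}Θ_{σ̂₂}(a − b√t) · Θ`. [sic: surplus «)»] …
  The intersection is thus the graph of the linear transformation `𝓑_{√−qf·Θ} : (a + b√t) · f · Θ ↦
  (−q/2)Nm(f)Θ_{σ̂₁}Θ_{σ̂₂}(a − b√t) · f · Θ`. Thus, `𝓑_{√−qf·Θ}((a + b√t) · f² · Θ) = (−q/2)Nm(f)Θ_{σ̂₁}Θ_{σ̂₂}(a − b√t) ·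
  γ(f) · f · Θ = (−q/2)Nm(f²)Θ_{σ̂₁}Θ_{σ̂₂}(a − b√t) · Θ = Nm(f²)𝓑_{√−q·Θ}((a + b√t) · Θ)`. We see that
  `𝓑_{√−qf·Θ} ∘ (f² · (•)) = Nm(f²)𝓑_{√−qΘ}`.»
* LEMMA 11.2.4, proof (p. 41 L69–80): «… The equality `𝓑_{√−qΘ}(x) = 𝓑_{√−qf·Θ}(x)` is thus equivalent to
  `γ(f) = Nm(f)f`, which is equivalent to `Nm(f) = 1` and `γ(f) = f`, which is equivalent to `f = ±1`.» [print has
  «Θ_{σ̂₁}Θ_{σ̂₁}» twice in this proof where «Θ_{σ̂₁}Θ_{σ̂₂}» is meant — typographic, ×1]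
* p. 41 L82–93: «Define an `F`-vector space structure on `⟨H^{1,1}(X, ℚ)⟩⁶` by `f · Θ²_{σ̂₁}Θ_{σ̂₂} = σ̂₁(f)Θ²_{σ̂₁}Θ_{σ̂₂}`,
  `f · Θ_{σ̂₁}Θ²_{σ̂₂} = σ̂₂(f)Θ_{σ̂₁}Θ²_{σ̂₂}`, so that `(f · Θ)³ = Nm(f)f · Θ³`.»
* LEMMA 11.2.5, proof (p. 41 L99–112): «The statement follows from the equality `B_{√−qf·Θ} = {(a + b√t)f⁻¹f · Θ −
  (q/6)Nm(f)γ((a + b√t)f⁻¹)f · Θ³} = {(a + b√t)Θ − (q/6)(a − b√t)f² · Θ³}`.»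
* COROLLARY 11.2.6 (1), proof (p. 42 L3–13): «Let `f ∈ F` be a non-zero element satisfying `η̂(f) = g^* ∈ End_{Hdg}(H¹(X, ℚ))`,
  for some `g ∈ End(X)`. (1) The class `Θ − (q/6)g^*(Θ³)` belongs to `B_{√−qNm(f)f·Θ}`. … Proof. (1) We have the
  equality `g^*(Θ³) = (f² · Θ)³ = Nm(f)²f² · Θ³`.»
* LEMMA 11.2.8, end of proof (p. 43 L3–21; `Nm(f) = 1`, `f² ≠ 1`, `X` a genus-4 Jacobian): «It remains to verify that the
  rank of `Φ(E₀ ⊠ E′)` is non-zero. The rank is equal to `χ(E₀ ⊗^L E′)`. The latter is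
  `∫_X (Θ − (q/2)Θ_{σ̂₁}Θ_{σ̂₂}Θ)(f² · Θ − (q/2)Θ_{σ̂₁}Θ_{σ̂₂}f⁻² · Θ) = −(q/2)(σ̂₁(f)⁻² + σ̂₂(f)⁻² + σ̂₁(f)² + σ̂₂(f)²)
  ∫_X (Θ_{σ̂₁}Θ_{σ̂₂})² = −(q/12)(σ̂₁(f)⁻² + σ̂₂(f)⁻² + σ̂₁(f)² + σ̂₂(f)²) ∫_X Θ⁴ ≠ 0`.»

## The model and what is proved (0 `def`, 0 named fact, 0 sorry)

`A` a commutative ring («`H^{ev}(X, ℂ)`», or `∧^*` with coefficients in a field containing `√t`, `√−q`), `Θ₁, Θ₂ ∈ A`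
(«`Θ_{σ̂₁}, Θ_{σ̂₂}`») with `h1 : Θ₁³ = 0`, `h2 : Θ₂³ = 0`; `Θ = Θ₁ + Θ₂`, `Θ̃ = Θ₁ − Θ₂`; scalars `a, b, q` and `s`
(«`√t`») are elements of `A` (central). An element `f ∈ F = ℚ(√t)` enters through its two embeddings
`(u, v) = (σ̂₁(f), σ̂₂(f))`, `γ` swaps them, `Nm(f) = uv`, and `f · Θ = uΘ₁ + vΘ₂` (p. 40 L79–85), `f · Θ³` per the
printed `F`-structure on degree 6. THEOREMS. §A: `theta_cube`, `thetaTilde_cube`, `theta_pow_four`, `theta_pow_five`,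
`theta_i_pow_four` («`Θ⁴_{σ̂ᵢ} = 0`»), `monomial_count` (the 9 monomials `Θ₁ⁱΘ₂ʲ`, `i, j ≤ 2`, behind «9-dimensional»);
§B: `exp_eq_alpha_add_beta` («`exp(√−qΘ) = α + √−qβ`», Mathlib `IsNilpotent.exp`, `(√−q)² = −q`, `Θ⁵ = 0`),
`r_mul_beta`, `alpha_sub_alphaTilde` («`α − α̃ = −2qΘ_{σ̂₁}Θ_{σ̂₂}`»); §C: `fTheta_sqrt_t` (`(c√t) · Θ = c√t Θ̃`); §D LEMMA 11.2.3:
`lemma1123_display` (both printed equalities), `lemma1123_chain` (the three-line chain, in the `(u, v)` model);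
§E: `fTheta_cube` («`(f · Θ)³ = Nm(f)f · Θ³`»); §F LEMMA 11.2.4: `lemma1124_iff` (`γ(f) = Nm(f)f ↔ (Nm(f) = 1 ∧ γ(f) = f)
↔ f = ±1`, for `f ≠ 0` in a field with an involutive automorphism `γ`, `Nm(f) = fγ(f)`); §G LEMMA 11.2.5:
`lemma1125_rewrite` (`Nm(f)γ(g)f = γ(gf)f²`, the substitution `g = (a + b√t)f⁻¹`); §H COR. 11.2.6 ∕ LEMMA 11.2.8:
`cor1126_cube` («`(f² · Θ)³ = Nm(f)²f² · Θ³`»), `fTheta_cube_eq` (`f · Θ³ = 3Θ_{σ̂₁}Θ_{σ̂₂}(f · Θ)`, so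
`(q/6)Θ³ = (q/2)Θ_{σ̂₁}Θ_{σ̂₂}Θ`), `lemma1128_product` (the integrand of the rank display expands, modulo `Θ_{σ̂ᵢ}³ = 0`, to
its degree-4 part plus `−(q/2)(u′ + v′ + u + v)(Θ_{σ̂₁}Θ_{σ̂₂})²`, `(u, v) = (σ̂₁(f)², σ̂₂(f)²)`, `(u′, v′) = (σ̂₁(f)⁻², σ̂₂(f)⁻²)`),
`lemma1128_top_degree` (`(Θ_{σ̂₁}Θ_{σ̂₂})² = Θ⁴/6`, whence «`−(q/12)(…)∫Θ⁴`»), `lemma1128_ne_zero` (over an ordered field: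
`q > 0`, the four squares positive, `∫Θ⁴ ≠ 0` ⇒ the rank is non-zero). BY VALUE ∕ NOT modelled: that
`Θ_{σ̂ᵢ}³ = 0` («since `H¹_{σ̂ᵢ}(X)` is 4-dimensional»), linear independence of the nine monomials (`Θ₁²Θ₂² = c[pt] ≠ 0`),
rationality ∕ Galois descent, the planes `B_{√−qf·Θ}` as subspaces, `M_f`, the ample-cone sentences, Question 11.2.2, `χ = ∫ ch·ch`
(HRR on an abelian variety) and that `∫_X` reads off the `Θ_{σ̂₁}²Θ_{σ̂₂}²`-coefficient, Example 11.2.7, the Hodge-type part of Lemma 11.2.8.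
Nothing here says any object is semiregular or that HC ∕ HC_CM ∕ HC_AV is proved.
-/

namespace Literature.AlgebraicGeometry.Markman2025.RMSecantPlane

/-! ### §A — `⟨H^{1,1}(X, ℚ)⟩`: powers of `Θ = Θ_{σ̂₁} + Θ_{σ̂₂}` and `Θ̃ = Θ_{σ̂₁} − Θ_{σ̂₂}` modulo `Θ_{σ̂ᵢ}³ = 0` -/

section Subalgebra

variable {A : Type*} [CommRing A] (Θ₁ Θ₂ : A)

/-- `Θ³ = 3Θ_{σ̂₁}²Θ_{σ̂₂} + 3Θ_{σ̂₁}Θ_{σ̂₂}²` when «`Θ³_{σ̂ᵢ} = 0`» (so `Θ³ ≠ 0` lives on the two degree-6 monomials).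
[cite: Markman2025SecantRealMultiplication, §11.2.1, v1 p. 40 L16–25] -/
theorem theta_cube (h1 : Θ₁ ^ 3 = 0) (h2 : Θ₂ ^ 3 = 0) :
    (Θ₁ + Θ₂) ^ 3 = 3 * Θ₁ ^ 2 * Θ₂ + 3 * Θ₁ * Θ₂ ^ 2 := by
  linear_combination h1 + h2

/-- `Θ̃³ = −3Θ_{σ̂₁}²Θ_{σ̂₂} + 3Θ_{σ̂₁}Θ_{σ̂₂}²` («`Θ̃ := Θ_{σ̂₁} − Θ_{σ̂₂}`»).
[cite: Markman2025SecantRealMultiplication, §11.2.1, v1 p. 40 L16–25] -/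
theorem thetaTilde_cube (h1 : Θ₁ ^ 3 = 0) (h2 : Θ₂ ^ 3 = 0) :
    (Θ₁ - Θ₂) ^ 3 = -(3 * Θ₁ ^ 2 * Θ₂) + 3 * Θ₁ * Θ₂ ^ 2 := by
  linear_combination h1 - h2

/-- `Θ⁴ = 6Θ_{σ̂₁}²Θ_{σ̂₂}²` (the `[pt]`-line) and likewise `Θ̃⁴ = 6Θ_{σ̂₁}²Θ_{σ̂₂}²`.
[cite: Markman2025SecantRealMultiplication, §11.2.1, v1 p. 40 L16–25 and L52–61] -/
theorem theta_pow_four (h1 : Θ₁ ^ 3 = 0) (h2 : Θ₂ ^ 3 = 0) :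
    (Θ₁ + Θ₂) ^ 4 = 6 * Θ₁ ^ 2 * Θ₂ ^ 2 ∧ (Θ₁ - Θ₂) ^ 4 = 6 * Θ₁ ^ 2 * Θ₂ ^ 2 := by
  constructor
  · linear_combination (Θ₁ + 4 * Θ₂) * h1 + (4 * Θ₁ + Θ₂) * h2
  · linear_combination (Θ₁ - 4 * Θ₂) * h1 + (-(4 * Θ₁) + Θ₂) * h2

/-- `Θ⁵ = 0` (every monomial of degree 5 in `Θ_{σ̂₁}, Θ_{σ̂₂}` contains a cube) — used for the truncation of `exp`.
[cite: Markman2025SecantRealMultiplication, §11.2.1, v1 p. 40 L16–25 and L52–55] -/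
theorem theta_pow_five (h1 : Θ₁ ^ 3 = 0) (h2 : Θ₂ ^ 3 = 0) : (Θ₁ + Θ₂) ^ 5 = 0 := by
  linear_combination (Θ₁ ^ 2 + 5 * Θ₁ * Θ₂ + 10 * Θ₂ ^ 2) * h1 + (10 * Θ₁ ^ 2 + 5 * Θ₁ * Θ₂ + Θ₂ ^ 2) * h2

/-- «since `Θ⁴_{σ̂ᵢ} = 0`» (p. 40 L46–47) — immediate from `Θ³_{σ̂ᵢ} = 0`.
[cite: Markman2025SecantRealMultiplication, §11.2.1, v1 p. 40 L45–47] -/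
theorem theta_i_pow_four (h1 : Θ₁ ^ 3 = 0) : Θ₁ ^ 4 = 0 := by
  linear_combination Θ₁ * h1

/-- «the subalgebra `⟨H^{1,1}(X, ℚ)⟩` is 9-dimensional»: the monomials `Θ_{σ̂₁}ⁱΘ_{σ̂₂}ʲ` with `0 ≤ i, j ≤ 2` number
`3 · 3 = 9` — in degrees `0, 2, 4, 6, 8` there are `1, 2, 3, 2, 1` of them, matching the printed basis
`{1 ∣ Θ, √tΘ̃ ∣ Θ², ΘΘ̃, Θ̃² ∣ Θ³, √tΘ̃³ ∣ [pt]}` (their linear independence is BY VALUE).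
[cite: Markman2025SecantRealMultiplication, §11.2.1, v1 p. 40 L19–25] -/
theorem monomial_count :
    (Finset.range 3 ×ˢ Finset.range 3).card = 9 ∧
      ((Finset.range 3 ×ˢ Finset.range 3).filter (fun ij => ij.1 + ij.2 = 0)).card = 1 ∧
      ((Finset.range 3 ×ˢ Finset.range 3).filter (fun ij => ij.1 + ij.2 = 1)).card = 2 ∧
      ((Finset.range 3 ×ˢ Finset.range 3).filter (fun ij => ij.1 + ij.2 = 2)).card = 3 ∧
      ((Finset.range 3 ×ˢ Finset.range 3).filter (fun ij => ij.1 + ij.2 = 3)).card = 2 ∧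
      ((Finset.range 3 ×ˢ Finset.range 3).filter (fun ij => ij.1 + ij.2 = 4)).card = 1 := by
  decide

end Subalgebra

/-! ### §B — «`exp(√−qΘ) = α + √−qβ`» and «`α − α̃ = −2qΘ_{σ̂₁}Θ_{σ̂₂}`» -/

section SecantPlane

open IsNilpotent

variable {A : Type*} [CommRing A] [Algebra ℚ A] (Θ₁ Θ₂ : A)

/-- «Set `α := 1 − (q/2)Θ² + (q²/4!)Θ⁴` and `β := Θ − (q/3!)Θ³`. Then `exp(√−qΘ) = α + √−qβ`» — with `r` standing for
`√−q` (`r² = −q`), `Θ⁵ = 0` (§A) and Mathlib's nilpotent exponential `exp x = Σ_{i<5} xⁱ/i!`; the rational factors are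
written as `ℚ`-scalars on the ring monomials (`(q/2)Θ² = ½ • (qΘ²)` etc.).
[cite: Markman2025SecantRealMultiplication, §11.2.1, v1 p. 40 L52–55] -/
theorem exp_eq_alpha_add_beta (h1 : Θ₁ ^ 3 = 0) (h2 : Θ₂ ^ 3 = 0) (q r : A) (hr : r ^ 2 = -q) :
    exp (r * (Θ₁ + Θ₂)) =
      (1 - (1 / 2 : ℚ) • (q * (Θ₁ + Θ₂) ^ 2) + (1 / 24 : ℚ) • (q ^ 2 * (Θ₁ + Θ₂) ^ 4))
        + (r * (Θ₁ + Θ₂) - (1 / 6 : ℚ) • (q * (r * (Θ₁ + Θ₂) ^ 3))) := by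
  have h5 : (r * (Θ₁ + Θ₂)) ^ 5 = 0 := by
    rw [mul_pow, theta_pow_five Θ₁ Θ₂ h1 h2, mul_zero]
  have hr3 : r ^ 3 = -(q * r) := by rw [_root_.pow_succ, hr]; ring
  have hr4 : r ^ 4 = q ^ 2 := by
    have : r ^ 4 = (r ^ 2) ^ 2 := by ring
    rw [this, hr, neg_sq]
  have e2 : (r * (Θ₁ + Θ₂)) ^ 2 = -(q * (Θ₁ + Θ₂) ^ 2) := by rw [mul_pow, hr]; ring
  have e3 : (r * (Θ₁ + Θ₂)) ^ 3 = -(q * (r * (Θ₁ + Θ₂) ^ 3)) := by rw [mul_pow, hr3]; ring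
  have e4 : (r * (Θ₁ + Θ₂)) ^ 4 = q ^ 2 * (Θ₁ + Θ₂) ^ 4 := by rw [mul_pow, hr4]
  rw [exp_eq_sum h5]
  simp only [Finset.sum_range_succ, Finset.sum_range_zero, pow_zero, pow_one, e2, e3, e4, smul_neg]
  norm_num [Nat.factorial]
  module

/-- «`α + √−qβ`» regrouped: the `r`-part above is `r · β` with `β = Θ − (q/3!)Θ³`.
[cite: Markman2025SecantRealMultiplication, §11.2.1, v1 p. 40 L52–55] -/
theorem r_mul_beta (q r : A) :
    r * ((Θ₁ + Θ₂) - (1 / 6 : ℚ) • (q * (Θ₁ + Θ₂) ^ 3))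
      = r * (Θ₁ + Θ₂) - (1 / 6 : ℚ) • (q * (r * (Θ₁ + Θ₂) ^ 3)) := by
  rw [mul_sub, mul_smul_comm]
  congr 2
  ring

/-- «Note that `α − α̃ = −2qΘ_{σ̂₁}Θ_{σ̂₂}`»: `Θ² − Θ̃² = 4Θ_{σ̂₁}Θ_{σ̂₂}` and `Θ⁴ = Θ̃⁴` (§A), so
`α − α̃ = −(q/2)(Θ² − Θ̃²) + (q²/4!)(Θ⁴ − Θ̃⁴) = −2qΘ_{σ̂₁}Θ_{σ̂₂}`.
[cite: Markman2025SecantRealMultiplication, §11.2.1, v1 p. 40 L60–61] -/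
theorem alpha_sub_alphaTilde (h1 : Θ₁ ^ 3 = 0) (h2 : Θ₂ ^ 3 = 0) (q : A) :
    (1 - (1 / 2 : ℚ) • (q * (Θ₁ + Θ₂) ^ 2) + (1 / 24 : ℚ) • (q ^ 2 * (Θ₁ + Θ₂) ^ 4))
      - (1 - (1 / 2 : ℚ) • (q * (Θ₁ - Θ₂) ^ 2) + (1 / 24 : ℚ) • (q ^ 2 * (Θ₁ - Θ₂) ^ 4))
      = -((2 : ℚ) • (q * Θ₁ * Θ₂)) := by
  obtain ⟨h4, h4t⟩ := theta_pow_four Θ₁ Θ₂ h1 h2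
  have hp : q * (Θ₁ + Θ₂) ^ 2 = q * Θ₁ ^ 2 + q * Θ₁ * Θ₂ + q * Θ₁ * Θ₂ + q * Θ₂ ^ 2 := by ring
  have hm : q * (Θ₁ - Θ₂) ^ 2 = q * Θ₁ ^ 2 - q * Θ₁ * Θ₂ - q * Θ₁ * Θ₂ + q * Θ₂ ^ 2 := by ring
  rw [h4, h4t, hp, hm]
  module

end SecantPlane

/-! ### §C–§E — the `F = ℚ(√t)`-structure: `f ↦ (σ̂₁ f, σ̂₂ f) = (u, v)`, `f · Θ = uΘ_{σ̂₁} + vΘ_{σ̂₂}` -/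

section FStructure

variable {A : Type*} [CommRing A] (Θ₁ Θ₂ : A)

/-- «`(a + b√t) · Θ = (a + b√t)Θ_{σ̂₁} + (a − b√t)Θ_{σ̂₂}`» specialised to `f = c√t` (`a = 0`, `b = c`): `(c√t) · Θ =
c√t(Θ_{σ̂₁} − Θ_{σ̂₂}) = c√tΘ̃` — why `√tΘ̃` is the `F`-multiple `√t · Θ` (p. 40 L28–38) and why
`B_{√−q c√t·Θ} = B_{√(−qc²t)Θ}` involves `Θ̃`. [cite: Markman2025SecantRealMultiplication, §11.2.1, v1 p. 40 L28–38 and L79–94] -/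
theorem fTheta_sqrt_t (s c : A) : (c * s) * Θ₁ + (-(c * s)) * Θ₂ = c * s * (Θ₁ - Θ₂) := by
  ring

/-- LEMMA 11.2.3, the displayed equality: «`−(q/3!)(aΘ³ + b√tΘ̃³) = −(q/2)Θ_{σ̂₁}Θ_{σ̂₂}[(a − b√t)Θ_{σ̂₁} +
(a + b√t)Θ_{σ̂₂}] = −(q/2)Θ_{σ̂₁}Θ_{σ̂₂}(a − b√t) · Θ`» (`s = √t`; `(a − b√t) · Θ = (a − b√t)Θ_{σ̂₁} + (a + b√t)Θ_{σ̂₂}`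
since `σ̂₂(a − b√t) = a + b√t`); the factor `q/3!` is written with `6w = q`, i.e. for any `w` with `6w = q` — in
particular over a `ℚ`-algebra. Modulo `Θ_{σ̂ᵢ}³ = 0`.
[cite: Markman2025SecantRealMultiplication, Lemma 11.2.3 (proof), v1 p. 41 L7–19] -/
theorem lemma1123_display (h1 : Θ₁ ^ 3 = 0) (h2 : Θ₂ ^ 3 = 0) (a b s w : A) :
    -(w * (a * (Θ₁ + Θ₂) ^ 3 + b * s * (Θ₁ - Θ₂) ^ 3))
        = -(3 * w) * Θ₁ * Θ₂ * ((a - b * s) * Θ₁ + (a + b * s) * Θ₂) ∧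
      (a - b * s) * Θ₁ + (a + b * s) * Θ₂ = (a - b * s) * Θ₁ + (a - b * -s) * Θ₂ := by
  constructor
  · linear_combination (-(w * a) - w * b * s) * h1 + (-(w * a) + w * b * s) * h2
  · ring

/-- LEMMA 11.2.3, the closing chain: with `f ↦ (u, v)`, `γ(f) ↦ (v, u)`, `Nm(f) = uv`, `g = a + b√t ↦ (g₁, g₂)` and the
graph map `𝓑_{√−qf·Θ} : (g · f · Θ) ↦ (−q/2)Nm(f)Θ_{σ̂₁}Θ_{σ̂₂}(γ(g) · f · Θ)`, the input `(a + b√t) · f² · Θ =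
((a + b√t)f) · f · Θ` is sent to «`(−q/2)Nm(f)Θ_{σ̂₁}Θ_{σ̂₂}(a − b√t) · γ(f) · f · Θ = (−q/2)Nm(f²)Θ_{σ̂₁}Θ_{σ̂₂}(a − b√t) · Θ
= Nm(f²)𝓑_{√−q·Θ}((a + b√t) · Θ)`» — the two middle equalities as ring identities (`c` stands for `−q/2`;
`Nm(f²) = Nm(f)²`). [cite: Markman2025SecantRealMultiplication, Lemma 11.2.3 (proof), v1 p. 41 L36–64] -/
theorem lemma1123_chain (c u v g₁ g₂ : A) :
    c * (u * v) * Θ₁ * Θ₂ * ((g₂ * v * u) * Θ₁ + (g₁ * u * v) * Θ₂)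
        = c * ((u * v) * (u * v)) * Θ₁ * Θ₂ * (g₂ * Θ₁ + g₁ * Θ₂) ∧
      c * ((u * v) * (u * v)) * Θ₁ * Θ₂ * (g₂ * Θ₁ + g₁ * Θ₂)
        = ((u * u) * (v * v)) * (c * Θ₁ * Θ₂ * (g₂ * Θ₁ + g₁ * Θ₂)) := by
  constructor <;> ring

/-- «Define an `F`-vector space structure on `⟨H^{1,1}(X, ℚ)⟩⁶` by `f · Θ²_{σ̂₁}Θ_{σ̂₂} = σ̂₁(f)Θ²_{σ̂₁}Θ_{σ̂₂}`,
`f · Θ_{σ̂₁}Θ²_{σ̂₂} = σ̂₂(f)Θ_{σ̂₁}Θ²_{σ̂₂}`, so that `(f · Θ)³ = Nm(f)f · Θ³`»: `(uΘ_{σ̂₁} + vΘ_{σ̂₂})³ =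
uv · (u · 3Θ²_{σ̂₁}Θ_{σ̂₂} + v · 3Θ_{σ̂₁}Θ²_{σ̂₂})` modulo `Θ_{σ̂ᵢ}³ = 0` (`Θ³ = 3Θ²_{σ̂₁}Θ_{σ̂₂} + 3Θ_{σ̂₁}Θ²_{σ̂₂}`, §A).
[cite: Markman2025SecantRealMultiplication, §11.2.1, v1 p. 41 L82–93] -/
theorem fTheta_cube (h1 : Θ₁ ^ 3 = 0) (h2 : Θ₂ ^ 3 = 0) (u v : A) :
    (u * Θ₁ + v * Θ₂) ^ 3 = (u * v) * (u * (3 * Θ₁ ^ 2 * Θ₂) + v * (3 * Θ₁ * Θ₂ ^ 2)) := by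
  linear_combination u ^ 3 * h1 + v ^ 3 * h2

end FStructure

/-! ### §F–§G — the scalar steps of LEMMAS 11.2.4 and 11.2.5 in `F = ℚ(√t)` -/

section Field

variable {F : Type*} [Field F] (γ : F →+* F)

/-- LEMMA 11.2.4: «The equality … is thus equivalent to `γ(f) = Nm(f)f`, which is equivalent to `Nm(f) = 1` and
`γ(f) = f`, which is equivalent to `f = ±1`» — for `f ≠ 0` in a field with a ring endomorphism `γ` (the Galois
involution of `F = ℚ(√t)`), `Nm(f) = fγ(f)`. [cite: Markman2025SecantRealMultiplication, Lemma 11.2.4 (proof), v1 p. 41 L78–80] -/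
theorem lemma1124_iff (f : F) (hf : f ≠ 0) :
    (γ f = (f * γ f) * f ↔ (f * γ f = 1 ∧ γ f = f)) ∧ ((f * γ f = 1 ∧ γ f = f) ↔ (f = 1 ∨ f = -1)) := by
  have hγf : γ f ≠ 0 := (map_ne_zero γ).mpr hf
  have key : γ f = (f * γ f) * f ↔ f ^ 2 = 1 := by
    constructor
    · intro h
      have : γ f * (f ^ 2 - 1) = 0 := by linear_combination -h
      rcases mul_eq_zero.mp this with h0 | h0
      · exact absurd h0 hγf
      · linear_combination h0
    · intro h; linear_combination (-(γ f)) * h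
  have sq : f ^ 2 = 1 ↔ (f = 1 ∨ f = -1) := by rw [pow_two]; exact mul_self_eq_one_iff
  constructor
  · rw [key]
    constructor
    · intro h
      rcases sq.mp h with rfl | rfl
      · simp
      · simp
    · rintro ⟨hN, hγ⟩
      rw [hγ] at hN; linear_combination hN
  · constructor
    · rintro ⟨hN, hγ⟩
      rw [hγ] at hN
      exact sq.mp (by linear_combination hN)
    · rintro (rfl | rfl) <;> simp

/-- LEMMA 11.2.5's rewriting: with `g = (a + b√t)f⁻¹` one has «`(a + b√t)f⁻¹f · Θ = (a + b√t)Θ`» and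
«`Nm(f)γ((a + b√t)f⁻¹)f · Θ³ = (a − b√t)f² · Θ³`» — the scalar identities `gf = a + b√t` and
`Nm(f)γ(g)f = γ(gf)f²` (`Nm(f) = fγ(f)`, `γ` multiplicative), `γ(a + b√t) = a − b√t`.
[cite: Markman2025SecantRealMultiplication, Lemma 11.2.5 (proof), v1 p. 41 L99–112] -/
theorem lemma1125_rewrite (f x : F) (hf : f ≠ 0) :
    (x * f⁻¹) * f = x ∧ (f * γ f) * γ (x * f⁻¹) * f = γ x * f ^ 2 := by
  constructor
  · rw [inv_mul_cancel_right₀ hf]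
  · rw [map_mul, map_inv₀]
    have hγf : γ f ≠ 0 := (map_ne_zero γ).mpr hf
    field_simp

end Field


/-! ### §H — COROLLARY 11.2.6 (1) and the rank display closing LEMMA 11.2.8 -/

section Rank

variable {A : Type*} [CommRing A] (Θ₁ Θ₂ : A)

/-- COR. 11.2.6 (1), proof: «We have the equality `g^*(Θ³) = (f² · Θ)³ = Nm(f)²f² · Θ³`» — the second equality is
§E's «`(f · Θ)³ = Nm(f)f · Θ³`» applied to `f²` (embedding pair `(u², v²)`, `Nm(f²) = Nm(f)²`); the first
(`g^*(Θ³) = (g^*Θ)³` for the ring map `g^*`, and part (2)'s «`g^*(Θ) = f² · Θ`») is BY VALUE. [cite: Markman2025SecantRealMultiplication, §11.2.1, Cor. 11.2.6 (proof), v1 p. 42 L12–13] -/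
theorem cor1126_cube (h1 : Θ₁ ^ 3 = 0) (h2 : Θ₂ ^ 3 = 0) (u v : A) :
    (u ^ 2 * Θ₁ + v ^ 2 * Θ₂) ^ 3 = (u * v) ^ 2 * (u ^ 2 * (3 * Θ₁ ^ 2 * Θ₂) + v ^ 2 * (3 * Θ₁ * Θ₂ ^ 2)) := by
  linear_combination u ^ 6 * h1 + v ^ 6 * h2

/-- `f · Θ³ = 3Θ_{σ̂₁}Θ_{σ̂₂}(f · Θ)` in the printed degree-6 `F`-structure (`f · Θ³ = σ̂₁(f)·3Θ²_{σ̂₁}Θ_{σ̂₂} +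
σ̂₂(f)·3Θ_{σ̂₁}Θ²_{σ̂₂}`); with `f = 1` this is `Θ³ = 3Θ_{σ̂₁}Θ_{σ̂₂}Θ`, i.e. `α₀ = Θ − (q/6)Θ³ = Θ − (q/2)Θ_{σ̂₁}Θ_{σ̂₂}Θ`
and `(q/6)f⁻² · Θ³ = (q/2)Θ_{σ̂₁}Θ_{σ̂₂}f⁻² · Θ` — the two factors of the rank integrand.
[cite: Markman2025SecantRealMultiplication, §11.2.1, Lemma 11.2.8 (proof), v1 p. 42 L50–52 and p. 43 L3–9] -/
theorem fTheta_cube_eq (u v : A) :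
    u * (3 * Θ₁ ^ 2 * Θ₂) + v * (3 * Θ₁ * Θ₂ ^ 2) = 3 * Θ₁ * Θ₂ * (u * Θ₁ + v * Θ₂) := by
  ring

/-- LEMMA 11.2.8, the integrand: «`∫_X (Θ − (q/2)Θ_{σ̂₁}Θ_{σ̂₂}Θ)(f² · Θ − (q/2)Θ_{σ̂₁}Θ_{σ̂₂}f⁻² · Θ) =
−(q/2)(σ̂₁(f)⁻² + σ̂₂(f)⁻² + σ̂₁(f)² + σ̂₂(f)²)∫_X (Θ_{σ̂₁}Θ_{σ̂₂})²`» — modulo `Θ_{σ̂ᵢ}³ = 0` the product is its degree-4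
part `Θ·(f² · Θ)` (killed by `∫_X`, BY VALUE) plus the printed top-degree term; `c` stands for `q/2`,
`f² · Θ = uΘ_{σ̂₁} + vΘ_{σ̂₂}`, `f⁻² · Θ = u′Θ_{σ̂₁} + v′Θ_{σ̂₂}`.
[cite: Markman2025SecantRealMultiplication, §11.2.1, Lemma 11.2.8 (proof), v1 p. 43 L3–15] -/
theorem lemma1128_product (h1 : Θ₁ ^ 3 = 0) (h2 : Θ₂ ^ 3 = 0) (c u v u' v' : A) :
    ((Θ₁ + Θ₂) - c * Θ₁ * Θ₂ * (Θ₁ + Θ₂)) * ((u * Θ₁ + v * Θ₂) - c * Θ₁ * Θ₂ * (u' * Θ₁ + v' * Θ₂))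
      = (Θ₁ + Θ₂) * (u * Θ₁ + v * Θ₂) - c * (u' + v' + u + v) * (Θ₁ * Θ₂) ^ 2 := by
  linear_combination (c ^ 2 * u' * Θ₁ * Θ₂ ^ 2 + c ^ 2 * (u' + v') * Θ₂ ^ 3 - c * (u + u') * Θ₂) * h1
    + (c ^ 2 * v' * Θ₁ ^ 2 * Θ₂ - c * (v + v') * Θ₁) * h2

/-- … «`= −(q/12)(σ̂₁(f)⁻² + σ̂₂(f)⁻² + σ̂₁(f)² + σ̂₂(f)²)∫_X Θ⁴`»: `(Θ_{σ̂₁}Θ_{σ̂₂})²` is `Θ⁴/6` (§A `theta_pow_four`), so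
`(q/2)·(Θ_{σ̂₁}Θ_{σ̂₂})²`-coefficients become `(q/12)·Θ⁴`-coefficients: `6·(c·S·(Θ₁Θ₂)²) = c·S·Θ⁴`.
[cite: Markman2025SecantRealMultiplication, §11.2.1, Lemma 11.2.8 (proof), v1 p. 43 L10–21] -/
theorem lemma1128_top_degree (h1 : Θ₁ ^ 3 = 0) (h2 : Θ₂ ^ 3 = 0) (c S : A) :
    6 * (c * S * (Θ₁ * Θ₂) ^ 2) = c * S * (Θ₁ + Θ₂) ^ 4 := by
  rw [(theta_pow_four Θ₁ Θ₂ h1 h2).1]; ring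

/-- … «`≠ 0`»: over an ordered field (the real values `σ̂ᵢ(f)^{±2}` of the embeddings), with `q > 0`, `σ̂ᵢ(f) ≠ 0` and
`∫_X Θ⁴ ≠ 0`, the number `−(q/12)(σ̂₁(f)⁻² + σ̂₂(f)⁻² + σ̂₁(f)² + σ̂₂(f)²)·∫_X Θ⁴` is non-zero.
[cite: Markman2025SecantRealMultiplication, §11.2.1, Lemma 11.2.8 (proof), v1 p. 43 L16–21] -/
theorem lemma1128_ne_zero {R : Type*} [Field R] [LinearOrder R] [IsStrictOrderedRing R] (q x y I : R) (hq : 0 < q) (hx : x ≠ 0) (hy : y ≠ 0)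
    (hI : I ≠ 0) : -(q / 12) * (x⁻¹ ^ 2 + y⁻¹ ^ 2 + x ^ 2 + y ^ 2) * I ≠ 0 := by
  have hpos : 0 < x⁻¹ ^ 2 + y⁻¹ ^ 2 + x ^ 2 + y ^ 2 := by positivity
  have h1 : -(q / 12) * (x⁻¹ ^ 2 + y⁻¹ ^ 2 + x ^ 2 + y ^ 2) ≠ 0 :=
    mul_ne_zero (neg_ne_zero.mpr (by positivity)) hpos.ne'
  exact mul_ne_zero h1 hI

end Rank

end Literature.AlgebraicGeometry.Markman2025.RMSecantPlane
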